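import Mathlib
import Summits.QuantumFields.QCD.Theses.PauliWegnerSea
import Literature.MathematicalPhysics.QuantumFieldTheory.QCDHeavyQuarkPropagator
import Literature.MathematicalPhysics.QuantumFieldTheory.QCDWickMinorMeasurability

/-!
# Stub `stub_aprioriHeavy` of line `crossing-split-integrability` (skeleton r4, lead gen 1)
(crux `Summit.QuantumFields.QCD.Theses.PauliWegnerSea.PhaseQuenchedFlavourDecay` =
`Summit.QuantumFields.QCD.Theses.WilsonMobilityGap.PhaseQuenchedFlavourDecay`, item stmt-QuantumFields-9151)

The DETERMINISTIC (hopping-parameter) corner of the line's a-priori stub `Upper → MinorMoments`: if all bare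
Wilson masses `m_f(k) = m_crit(k) + a_k m_f / Z_m(k)` are eventually `≥ m₀ > 0`, then on every torus and for
every `SU(3)` field the propagator `G = (diracMatrix U mq)⁻¹` has entries of norm `≤ m₀⁻¹`
(`norm_inv_diracMatrix_apply_le_of_le`; off-flavour entries vanish, `inv_diracMatrix_apply_eq_zero_of_fst_ne`),
hence by the Leibniz expansion every `r × r` Wick minor has norm `≤ r!·m₀^{-r}`; with `ε = 1` and
`C_r = (r!·m₀^{-r})^{1+1}` the minors have phase-quenched `(1+ε)`-moments `≤ C_r`, uniformly in the torus and in
`k` (bounded measurable functions under the phase-quenched PROBABILITY measure — `det D ≠ 0` everywhere here,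
`det_diracMatrix_ne_zero_of_pos`, `isProbabilityMeasure_qcdLatticeMeasure`).  Montvay–Münster §5.1.2 regime
(`κ < 1/8`); `N_f = 0` is included (the hypothesis is vacuous there).  The statement below is the REGISTERED
stub signature (tree vocabulary only).
-/

noncomputable section

namespace Summit.QuantumFields.QCD.Cruxes.PhaseQuenchedFlavourDecay.CrossingSplitIntegrability

open scoped BigOperators
open MeasureTheory Filter
open Literature.MathematicalPhysics.QuantumFieldTheory Literature.MathematicalPhysics.QuantumLattice
  Literature.Probability.LatticeModels

/-- Leibniz bound: a complex `r × r` matrix with entries of norm `≤ x` has `‖det‖ ≤ r!·x^r`. -/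
private theorem norm_det_le_of_entry_le {r : ℕ} (M : Matrix (Fin r) (Fin r) ℂ) {x : ℝ}
    (h : ∀ a b, ‖M a b‖ ≤ x) : ‖M.det‖ ≤ (r.factorial : ℝ) * x ^ r := by
  rw [Matrix.det_apply']
  calc ‖∑ σ : Equiv.Perm (Fin r), ((Equiv.Perm.sign σ : ℤ) : ℂ) * ∏ i, M (σ i) i‖
      ≤ ∑ σ : Equiv.Perm (Fin r), ‖((Equiv.Perm.sign σ : ℤ) : ℂ) * ∏ i, M (σ i) i‖ := norm_sum_le _ _
    _ ≤ ∑ _σ : Equiv.Perm (Fin r), x ^ r := by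
        refine Finset.sum_le_sum fun σ _ => ?_
        rw [norm_mul]
        have hsign : ‖((Equiv.Perm.sign σ : ℤ) : ℂ)‖ = 1 := by
          rcases Int.units_eq_one_or (Equiv.Perm.sign σ) with h1 | h1 <;> simp [h1]
        rw [hsign, one_mul, norm_prod]
        calc ∏ i, ‖M (σ i) i‖ ≤ ∏ _i : Fin r, x :=
              Finset.prod_le_prod (fun i _ => norm_nonneg _) fun i _ => h _ _
          _ = x ^ r := by rw [Finset.prod_const, Finset.card_univ, Fintype.card_fin]
    _ = (r.factorial : ℝ) * x ^ r := by
        rw [Finset.sum_const, Finset.card_univ, Fintype.card_perm, Fintype.card_fin, nsmul_eq_mul]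

/-- Heavy entry bound: with all bare masses `≥ m₀ > 0`, EVERY entry of `(diracMatrix U mq)⁻¹` (any two quark
variables, any flavours) has norm `≤ m₀⁻¹`, on every torus and for every field. -/
private theorem norm_inv_diracMatrix_apply_le_inv {Nf S : ℕ} [NeZero S] (U : GaugeConfig 4 S SU3)
    (mq : Fin Nf → ℝ) {m₀ : ℝ} (hm₀ : 0 < m₀) (hM : ∀ f, m₀ ≤ mq f) (v w : QuarkVar Nf S) :
    ‖(diracMatrix U mq)⁻¹ (quarkEquiv v) (quarkEquiv w)‖ ≤ m₀⁻¹ := by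
  obtain ⟨f, p⟩ := v
  obtain ⟨g, q⟩ := w
  by_cases hfg : f = g
  · subst hfg
    refine (norm_inv_diracMatrix_apply_le_of_le U mq hm₀ hM f p q 0).trans ?_
    have hθ0 : 0 ≤ 4 / (m₀ + 4) := by positivity
    have hθ1 : 4 / (m₀ + 4) ≤ 1 := by rw [div_le_one (by linarith)]; linarith
    calc m₀⁻¹ * (4 / (m₀ + 4)) ^ (p.1 0 - q.1 0).valMinAbs.natAbs ≤ m₀⁻¹ * 1 := by
          gcongr
          exact pow_le_one₀ hθ0 hθ1
      _ = m₀⁻¹ := mul_one _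
  · rw [inv_diracMatrix_apply_eq_zero_of_fst_ne U mq (v := (f, p)) (w := (g, q)) hfg, norm_zero]
    positivity

/-- Registered stub `stub_aprioriHeavy` (skeleton r4) of line `crossing-split-integrability` for crux
stmt-QuantumFields-9151 — the hopping-parameter corner of the a-priori minor-moment bound: all bare masses eventually
`≥ m₀ > 0` ⇒ `MinorMoments` with `ε = 1`, `C_r = (r!·m₀^{-r})^{1+1}`. -/
theorem stub_aprioriHeavy :
    ∀ (Nf : ℕ) (reg : QCDRegularisation Nf) (m : Fin Nf → ℝ),
      (∃ m₀ : ℝ, 0 < m₀ ∧ ∀ᶠ k in atTop, ∀ f : Fin Nf, m₀ ≤ reg.mcrit k + reg.a k * m f / reg.Zm k) →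
      (∃ ε : ℝ, 0 < ε ∧ ∀ r : ℕ, ∃ C : ℝ, ∀ᶠ k in atTop, ∀ S : ℕ, reg.L k ≤ S →
        ∀ I J : Fin r → QuarkVar Nf (2 * S + 1),
          Integrable (fun U : GaugeConfig 4 (2 * S + 1) SU3 =>
              ‖(Matrix.of fun a b : Fin r => (diracMatrix U fun fl => reg.mcrit k + reg.a k * m fl / reg.Zm k)⁻¹
                (quarkEquiv (I a)) (quarkEquiv (J b))).det‖ ^ (1 + ε))
              (qcdLatticeMeasure (2 * S + 1) (reg.β k) fun fl => reg.mcrit k + reg.a k * m fl / reg.Zm k) ∧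
            qcdPhaseQuenchedExpect (reg.β k) (2 * S + 1) (fun fl => reg.mcrit k + reg.a k * m fl / reg.Zm k)
                (fun U : GaugeConfig 4 (2 * S + 1) SU3 =>
                  ‖(Matrix.of fun a b : Fin r => (diracMatrix U fun fl => reg.mcrit k + reg.a k * m fl / reg.Zm k)⁻¹
                    (quarkEquiv (I a)) (quarkEquiv (J b))).det‖ ^ (1 + ε)) ≤ C) := by
  intro Nf reg m hH
  obtain ⟨m₀, hm₀, hM⟩ := hH
  refine ⟨1, one_pos, fun r => ⟨((r.factorial : ℝ) * m₀⁻¹ ^ r) ^ (1 + 1 : ℝ), ?_⟩⟩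
  filter_upwards [hM] with k hk S _hS I J
  set mq : Fin Nf → ℝ := fun fl => reg.mcrit k + reg.a k * m fl / reg.Zm k with hmq
  have hkq : ∀ f, m₀ ≤ mq f := fun f => by rw [hmq]; exact hk f
  have hpos : ∀ f, 0 < mq f := fun f => hm₀.trans_le (hkq f)
  set B : ℝ := (r.factorial : ℝ) * m₀⁻¹ ^ r with hB
  set φ : GaugeConfig 4 (2 * S + 1) SU3 → ℝ := fun U =>
    ‖(Matrix.of fun a b : Fin r => (diracMatrix U mq)⁻¹ (quarkEquiv (I a)) (quarkEquiv (J b))).det‖ ^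
      (1 + 1 : ℝ) with hφ
  -- pointwise bound
  have hφ0 : ∀ U, 0 ≤ φ U := fun U => Real.rpow_nonneg (norm_nonneg _) _
  have hφB : ∀ U, φ U ≤ B ^ (1 + 1 : ℝ) := fun U =>
    Real.rpow_le_rpow (norm_nonneg _)
      (norm_det_le_of_entry_le _ fun a b => norm_inv_diracMatrix_apply_le_inv U mq hm₀ hkq (I a) (J b))
      (by norm_num)
  have hφn : ∀ U, ‖φ U‖ ≤ B ^ (1 + 1 : ℝ) := fun U => by
    rw [Real.norm_eq_abs, abs_of_nonneg (hφ0 U)]; exact hφB U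
  -- measurability
  have hmeas : Measurable φ :=
    (measurable_det_inv_diracMatrix (S := 2 * S + 1) mq (fun a => quarkEquiv (I a))
      (fun b => quarkEquiv (J b))).norm.pow_const _
  -- the phase-quenched measure is a probability measure (det ≠ 0 everywhere)
  have hZ : 0 < ∫ U, ‖(diracMatrix U mq).det‖
      ∂(wilsonMeasure (d := 4) (L := 2 * S + 1) (fundamentalRep (Fin 3)) (reg.β k)) :=
    integral_norm_det_diracMatrix_pos_of_exists (reg.β k) mq
      ⟨fun _ => 1, det_diracMatrix_ne_zero_of_pos _ mq hpos⟩
  haveI := isProbabilityMeasure_qcdLatticeMeasure (S := 2 * S + 1) (reg.β k) mq hZ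
  have hint : Integrable φ (qcdLatticeMeasure (2 * S + 1) (reg.β k) mq) :=
    Integrable.of_bound hmeas.aestronglyMeasurable (B ^ (1 + 1 : ℝ)) (Eventually.of_forall hφn)
  refine ⟨hint, ?_⟩
  rw [qcdPhaseQuenchedExpect_eq_integral_qcdLatticeMeasure]
  calc ∫ U, φ U ∂(qcdLatticeMeasure (2 * S + 1) (reg.β k) mq)
      ≤ ∫ _U, B ^ (1 + 1 : ℝ) ∂(qcdLatticeMeasure (2 * S + 1) (reg.β k) mq) :=
        integral_mono hint (integrable_const _) hφB
    _ = B ^ (1 + 1 : ℝ) := by simp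

end Summit.QuantumFields.QCD.Cruxes.PhaseQuenchedFlavourDecay.CrossingSplitIntegrability

end
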